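import Literature.Probability.RandomPlanarGeometry.SkorokhodSRWEmbedding
import Mathlib.Probability.Moments.Basic
import HarnessLib

/-!
# Skorokhod embedding of the simple random walk: exponential control of the embedding times

Topic `Literature/Probability/RandomPlanarGeometry`, sub-namespace `SkorokhodSRW`; theorems only;
no definition and no named fact is introduced.

Continuation of `SkorokhodSRWEmbedding` (brick B3 of Part B of the printed proof of
`LSW2001_srw_nonIntersection_five_eighths`). Lawler, *Cut times for simple random walk*, EJP
**1** (1996), paper 13, §3, second display: "It is easy to check that `E(τ₁) = 1` and
`E(e^{tτ₁}) < ∞` for some `t > 0`. Standard exponential estimates give that for every `ε > 0`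
there is a `δ > 0` and an `a < ∞` such that
`P{sup_{0 ≤ i ≤ n} |τ_i - i| ≥ n^{1/2+ε}} ≤ a e^{-n^δ}`."
We prove exactly this (`measureReal_exists_le_abs_tdev_le`), spelling out the "standard
exponential estimates":

* `lintegral_exp_mul_gap_zero_le`, `integrable_exp_mul_gap`: **exponential moments of the
  gaps** from the geometric tail `P[4m < Δτ] ≤ θ₀^m` of `SkorokhodSRWEmbedding`
  (discrete layer cake: `e^{λT} ≤ 1 + ∑ₘ (e^{4λ(m+1)} - e^{4λm}) 𝟙{4m < T}`), for every
  `λ ≥ 0` with `e^{4λ} θ₀ < 1`; such a `λ > 0` exists (`exists_rate`);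
* `integral_exp_mul_sub_one_le`: the **centred m.g.f. bound** `E e^{θ(Δτ - 1)} ≤ e^{Kθ²}` for
  `|θ| ≤ λ/2`, `K = 16 e^λ E[e^{λΔτ}]/λ²` (from `e^x ≤ 1 + x + 2x² e^{|x|}` and `E Δτ = 1`);
* `integral_exp_mul_tdev`: **`E e^{θ(τ_n - n)} = (E e^{θ(Δτ - 1)})^n`** by the renewal
  independence (`indepFun_gap_zero_comp_next`) and measure preservation of `next`;
* `measureReal_le_tdev_le`, `measureReal_tdev_le_neg_le`: **Chernoff bounds**
  `P[±(τ_k - k) ≥ t] ≤ exp(-min(t²/(4nK), λt/4))` for `k ≤ n`;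
* `measureReal_exists_le_abs_tdev_le`: **Lawler's display**, `∀ ε > 0 ∃ δ > 0 ∃ a,
  ∀ n ≥ 1, P[∃ k ≤ n, n^{1/2+ε} ≤ |τ_k - k|] ≤ a e^{-n^δ}` (union bound + absorption of the
  polynomial prefactor, `rpow_mul_exp_neg_mul_le`).

## References

* G. F. Lawler, *Cut times for simple random walk*, Electron. J. Probab. **1** (1996), no. 13,
  §3. [Lawler1996CutTimes]
* R. Durrett, *Probability: Theory and Examples*, 5th ed. (2019), §2.7 (large deviations /
  Chernoff bounds) and Thm. 8.2.1. [Durrett2019]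
-/

noncomputable section

open MeasureTheory ProbabilityTheory Filter Set Real
open scoped NNReal ENNReal Topology BigOperators

namespace Literature.Probability.RandomPlanarGeometry

namespace SkorokhodSRW

/-! ### Elementary real inequalities -/

/-- **`e^x ≤ 1 + x + 2x² e^{|x|}` for all real `x`** (for `|x| ≤ 1` from
`|e^x - 1 - x| ≤ x²`, for `|x| > 1` from `e^x ≤ e^{|x|} ≤ x² e^{|x|}` and `1 + x + x² ≥ 0`).
[folklore] -/
theorem exp_le_one_add_add_sq_mul_exp_abs (x : ℝ) : exp x ≤ 1 + x + 2 * x ^ 2 * exp |x| := by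
  have h1 : x ^ 2 ≤ x ^ 2 * exp |x| :=
    le_mul_of_one_le_right (sq_nonneg x) (Real.one_le_exp (abs_nonneg x))
  rcases le_or_gt |x| 1 with hx | hx
  · have h := (abs_le.1 (Real.abs_exp_sub_one_sub_id_le hx)).2
    have h0 : 0 ≤ x ^ 2 * exp |x| := by positivity
    linarith
  · have hx2 : 1 ≤ x ^ 2 := by
      have h' : (1 : ℝ) ≤ |x| := hx.le
      calc (1 : ℝ) = 1 ^ 2 := by norm_num
        _ ≤ |x| ^ 2 := pow_le_pow_left₀ zero_le_one h' 2
        _ = x ^ 2 := sq_abs x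
    have h2 : exp x ≤ exp |x| := Real.exp_le_exp.2 (le_abs_self x)
    have h3 : exp |x| ≤ x ^ 2 * exp |x| := le_mul_of_one_le_left (Real.exp_nonneg _) hx2
    have h4 : 0 ≤ 1 + x + x ^ 2 := by nlinarith [sq_nonneg (x + 1 / 2)]
    linarith

/-- **`z^s e^{-bz} ≤ (s/b)^s e^{-s}`** for `z ≥ 0`, `b, s > 0` (the maximum of `z^s e^{-bz}` is at
`z = s/b`; from `u ≤ e^{u-1}`). [folklore] -/
theorem rpow_mul_exp_neg_mul_le {z b s : ℝ} (hz : 0 ≤ z) (hb : 0 < b) (hs : 0 < s) :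
    z ^ s * exp (-(b * z)) ≤ (s / b) ^ s * exp (-s) := by
  set u := b * z / s with hu
  have hu0 : 0 ≤ u := by positivity
  -- `u ≤ e^{u-1}`
  have hue : u ≤ exp (u - 1) := by linarith [Real.add_one_le_exp (u - 1)]
  -- `u^s ≤ e^{s(u-1)}`
  have hus : u ^ s ≤ exp (s * (u - 1)) := by
    calc u ^ s ≤ (exp (u - 1)) ^ s := Real.rpow_le_rpow hu0 hue hs.le
      _ = exp (s * (u - 1)) := by rw [← Real.exp_mul, mul_comm]
  have hz' : z = (s / b) * u := by rw [hu]; field_simp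
  have hsb : 0 ≤ s / b := by positivity
  rw [hz', Real.mul_rpow hsb hu0]
  calc (s / b) ^ s * u ^ s * exp (-(b * (s / b * u)))
      ≤ (s / b) ^ s * exp (s * (u - 1)) * exp (-(b * (s / b * u))) := by
        gcongr
    _ = (s / b) ^ s * exp (-s) := by
        rw [mul_assoc, ← Real.exp_add]
        congr 2
        field_simp
        ring

/-- Completing the square: `-c y² + y ≤ -(c/2) y² + 1/(2c)` (`c > 0`). [folklore] -/
theorem neg_mul_sq_add_le {c : ℝ} (hc : 0 < c) (y : ℝ) :
    -(c * y ^ 2) + y ≤ -(c / 2 * y ^ 2) + 1 / (2 * c) := by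
  have h : 0 ≤ c / 2 * (y - 1 / c) ^ 2 := by positivity
  have h' : c / 2 * (y - 1 / c) ^ 2 = c / 2 * y ^ 2 - y + 1 / (2 * c) := by
    field_simp
    ring
  linarith

/-! ### The centred embedding times `τ_n - n` -/

/-- `τ_n - n = ∑_{k<n} (Δτ_k - 1)`. [folklore] -/
theorem tdev_eq_sum (n : ℕ) (p : C(ℝ≥0, ℝ)) :
    (embTime n p : ℝ) - n = ∑ k ∈ Finset.range n, (gap k p - 1) := by
  rw [coe_embTime, Finset.sum_sub_distrib]
  simp

/-- `τ_0 - 0 = 0`. [folklore] -/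
theorem tdev_zero (p : C(ℝ≥0, ℝ)) : (embTime 0 p : ℝ) - (0 : ℕ) = 0 := by simp

/-- **Renewal recursion**: `τ_{n+1} - (n+1) = (Δτ_0 - 1) + (τ_n - n) ∘ next`. [folklore] -/
theorem tdev_succ' (n : ℕ) (p : C(ℝ≥0, ℝ)) :
    (embTime (n + 1) p : ℝ) - (n + 1 : ℕ) = (gap 0 p - 1) + ((embTime n (next p) : ℝ) - n) := by
  rw [tdev_eq_sum, tdev_eq_sum, Finset.sum_range_succ' (fun k ↦ gap k p - 1)]
  simp only [gap_succ]
  ring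

/-- **Discrete layer cake for the exponential**: for `T ≥ 0`, `λ ≥ 0`,
`e^{λT} ≤ 1 + ∑ₘ (e^{4λ(m+1)} - e^{4λm}) 𝟙{4m < T}` in `ℝ≥0∞` (the sum has `⌈T/4⌉` nonzero
terms and telescopes to `e^{4λ⌈T/4⌉} - 1 ≥ e^{λT} - 1`; for `T < 0` both sides are trivial).
[folklore] -/
theorem ofReal_exp_mul_le_tsum {T l : ℝ} (hl : 0 ≤ l) :
    ENNReal.ofReal (exp (l * T)) ≤ 1 + ∑' m : ℕ,
      ENNReal.ofReal (exp (4 * l * (m + 1)) - exp (4 * l * m)) * (if (4 * m : ℝ) < T then 1 else 0) := by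
  set K := ⌈T / 4⌉₊ with hK
  have hiff : ∀ m : ℕ, (4 * m : ℝ) < T ↔ m < K := fun m ↦ by
    rw [hK, Nat.lt_ceil, lt_div_iff₀ (by norm_num : (0 : ℝ) < 4), mul_comm]
  have hmono : ∀ m : ℕ, exp (4 * l * m) ≤ exp (4 * l * (m + 1)) := fun m ↦
    Real.exp_le_exp.2 (by nlinarith)
  have htsum : ∑' m : ℕ, ENNReal.ofReal (exp (4 * l * (m + 1)) - exp (4 * l * m)) *
      (if (4 * m : ℝ) < T then 1 else 0) = ENNReal.ofReal (exp (4 * l * K) - 1) := by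
    rw [tsum_eq_sum (s := Finset.range K)]
    · have : ∀ m ∈ Finset.range K, ENNReal.ofReal (exp (4 * l * (m + 1)) - exp (4 * l * m)) *
          (if (4 * m : ℝ) < T then 1 else 0) =
          ENNReal.ofReal (exp (4 * l * ((m + 1 : ℕ) : ℝ)) - exp (4 * l * m)) := by
        intro m hm
        rw [if_pos ((hiff m).2 (Finset.mem_range.1 hm)), mul_one]
        push_cast
        rfl
      rw [Finset.sum_congr rfl this, ← ENNReal.ofReal_sum_of_nonneg]
      · congr 1
        rw [Finset.sum_range_sub (fun m : ℕ ↦ exp (4 * l * (m : ℝ))) K]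
        simp
      · intro m _
        have := hmono m
        push_cast at this ⊢
        linarith
    · intro m hm
      rw [if_neg (fun h' ↦ hm (Finset.mem_range.2 ((hiff m).1 h'))), mul_zero]
  rw [htsum]
  have hTK : T ≤ 4 * K := by
    have := Nat.le_ceil (T / 4)
    rw [← hK] at this
    linarith [(div_le_iff₀ (by norm_num : (0 : ℝ) < 4)).1 this]
  have hexpK : 1 ≤ exp (4 * l * K) := Real.one_le_exp (by positivity)
  calc ENNReal.ofReal (exp (l * T)) ≤ ENNReal.ofReal (exp (4 * l * K)) :=
        ENNReal.ofReal_le_ofReal (Real.exp_le_exp.2 (by nlinarith))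
    _ = 1 + ENNReal.ofReal (exp (4 * l * K) - 1) := by
        rw [← ENNReal.ofReal_one, ← ENNReal.ofReal_add zero_le_one (by linarith)]
        congr 1
        ring

/-- **A positive admissible rate exists**: `λ = (1 - θ₀)/8 > 0` satisfies `e^{4λ} θ₀ < 1`
(`e^x ≤ 1/(1-x)`, `θ₀ < 1`). [folklore] -/
theorem exists_rate : ∃ l : ℝ, 0 < l ∧ exp (4 * l) * (gaussianReal 0 1).real (Ioo (-1) 1) < 1 := by
  set ρ := (gaussianReal 0 1).real (Ioo (-1) 1) with hρ
  have h0 : 0 ≤ ρ := measureReal_nonneg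
  have h1 : ρ < 1 := gaussianReal_real_Ioo_neg_one_one_lt_one
  refine ⟨(1 - ρ) / 8, by linarith, ?_⟩
  have hx0 : 0 ≤ (1 - ρ) / 2 := by linarith
  have hx1 : (1 - ρ) / 2 < 1 := by linarith
  have hexp : exp (4 * ((1 - ρ) / 8)) ≤ 1 / (1 - (1 - ρ) / 2) := by
    rw [show 4 * ((1 - ρ) / 8) = (1 - ρ) / 2 by ring]
    exact Real.exp_bound_div_one_sub_of_interval hx0 hx1
  have hden : 0 < 1 - (1 - ρ) / 2 := by linarith
  calc exp (4 * ((1 - ρ) / 8)) * ρ ≤ 1 / (1 - (1 - ρ) / 2) * ρ := by gcongr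
    _ < 1 := by
        rw [div_mul_eq_mul_div, one_mul, div_lt_one hden]
        linarith

section Law

variable [MeasurableSpace C(ℝ≥0, ℝ)] [BorelSpace C(ℝ≥0, ℝ)]

/-- `τ_n - n` is measurable. [folklore] -/
theorem measurable_tdev (n : ℕ) : Measurable (fun p ↦ (embTime n p : ℝ) - n) :=
  (measurable_embTime n).coe_nnreal_real.sub measurable_const

/-! ### Exponential moments of the gaps -/

/-- **Exponential moment of the gap from the geometric tail**: for `λ ≥ 0`,
`∫⁻ e^{λ Δτ₀} ≤ 1 + (e^{4λ} - 1) · ∑ₘ (e^{4λ} θ₀)^m`, `θ₀ = P[|N(0,1)| < 1]`. Lawler (1996), §3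
("`E(e^{tτ₁}) < ∞` for some `t > 0`"). [cite: Lawler1996CutTimes, §3] -/
theorem lintegral_exp_mul_gap_zero_le {l : ℝ} (hl : 0 ≤ l) :
    ∫⁻ p, ENNReal.ofReal (exp (l * gap 0 p)) ∂wienerLawC ≤
      1 + ENNReal.ofReal (exp (4 * l) - 1) *
        ∑' m : ℕ, (ENNReal.ofReal (exp (4 * l)) * gaussianReal 0 1 (Ioo (-1) 1)) ^ m := by
  set E : ℕ → Set C(ℝ≥0, ℝ) := fun m ↦ {p | (4 * m : ℝ) < gap 0 p} with hE
  have hEm : ∀ m, MeasurableSet (E m) := fun m ↦ measurable_gap 0 measurableSet_Ioi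
  have hw : ∀ m : ℕ, ENNReal.ofReal (exp (4 * l * (m + 1)) - exp (4 * l * m)) =
      ENNReal.ofReal (exp (4 * l) - 1) * ENNReal.ofReal (exp (4 * l)) ^ m := by
    intro m
    rw [← ENNReal.ofReal_pow (Real.exp_nonneg _), ← ENNReal.ofReal_mul (by
      linarith [Real.one_le_exp (by positivity : 0 ≤ 4 * l)])]
    congr 1
    rw [← Real.exp_nat_mul, show 4 * l * (m + 1) = 4 * l + 4 * l * m by ring, Real.exp_add]
    ring_nf
  -- pointwise bound
  have hpt : ∀ p, ENNReal.ofReal (exp (l * gap 0 p)) ≤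
      1 + ∑' m : ℕ, ENNReal.ofReal (exp (4 * l * (m + 1)) - exp (4 * l * m)) * (E m).indicator 1 p := by
    intro p
    refine (ofReal_exp_mul_le_tsum (T := gap 0 p) hl).trans ?_
    gcongr with m
    by_cases hm : (4 * m : ℝ) < gap 0 p
    · rw [if_pos hm, indicator_of_mem (by exact hm), Pi.one_apply]
    · rw [if_neg hm]
      exact bot_le
  calc ∫⁻ p, ENNReal.ofReal (exp (l * gap 0 p)) ∂wienerLawC
      ≤ ∫⁻ p, 1 + ∑' m : ℕ, ENNReal.ofReal (exp (4 * l * (m + 1)) - exp (4 * l * m)) *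
          (E m).indicator 1 p ∂wienerLawC := lintegral_mono hpt
    _ = 1 + ∑' m : ℕ, ENNReal.ofReal (exp (4 * l * (m + 1)) - exp (4 * l * m)) * wienerLawC (E m) := by
        rw [lintegral_add_left measurable_const, lintegral_const, measure_univ, mul_one,
          lintegral_tsum]
        · congr 1
          refine tsum_congr fun m ↦ ?_
          rw [lintegral_const_mul' _ _ ENNReal.ofReal_ne_top, lintegral_indicator_one (hEm m)]
        · intro m
          exact ((measurable_const.indicator (hEm m)).const_mul _).aemeasurable
    _ ≤ 1 + ∑' m : ℕ, ENNReal.ofReal (exp (4 * l * (m + 1)) - exp (4 * l * m)) *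
          gaussianReal 0 1 (Ioo (-1) 1) ^ m := by
        gcongr with m
        exact measure_lt_gap_zero_le_pow m
    _ = 1 + ENNReal.ofReal (exp (4 * l) - 1) *
          ∑' m : ℕ, (ENNReal.ofReal (exp (4 * l)) * gaussianReal 0 1 (Ioo (-1) 1)) ^ m := by
        rw [← ENNReal.tsum_mul_left]
        congr 1
        refine tsum_congr fun m ↦ ?_
        rw [hw m, mul_pow, mul_assoc]

/-- **The gaps have exponential moments**: if `λ ≥ 0` and `e^{4λ} θ₀ < 1` then `e^{λ Δτ_k}` is
integrable. Lawler (1996), §3 ("`E(e^{tτ₁}) < ∞` for some `t > 0`"). [cite: Lawler1996CutTimes, §3] -/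
theorem integrable_exp_mul_gap {l : ℝ} (hl : 0 ≤ l)
    (hρ : exp (4 * l) * (gaussianReal 0 1).real (Ioo (-1) 1) < 1) (k : ℕ) :
    Integrable (fun p ↦ exp (l * gap k p)) wienerLawC := by
  -- reduce to `k = 0` by identical distribution
  suffices h0 : Integrable (fun p ↦ exp (l * gap 0 p)) wienerLawC by
    have hid := (identDistrib_gap k).comp (u := fun x : ℝ ↦ exp (l * x))
      ((measurable_const.mul measurable_id).exp)
    exact hid.symm.integrable_snd h0
  refine ⟨((measurable_gap 0).const_mul l).exp.aestronglyMeasurable, ?_⟩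
  rw [hasFiniteIntegral_iff_ofReal (ae_of_all _ fun p ↦ (Real.exp_nonneg _))]
  refine (lintegral_exp_mul_gap_zero_le hl).trans_lt ?_
  have hr : ENNReal.ofReal (exp (4 * l)) * gaussianReal 0 1 (Ioo (-1) 1) < 1 := by
    rw [show gaussianReal 0 1 (Ioo (-1) 1) = ENNReal.ofReal ((gaussianReal 0 1).real (Ioo (-1) 1)) by
      rw [measureReal_def, ENNReal.ofReal_toReal (measure_ne_top _ _)],
      ← ENNReal.ofReal_mul (Real.exp_nonneg _), ← ENNReal.ofReal_one]
    exact (ENNReal.ofReal_lt_ofReal_iff zero_lt_one).2 hρ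
  rw [ENNReal.tsum_geometric]
  refine ENNReal.add_lt_top.2 ⟨ENNReal.one_lt_top, ENNReal.mul_lt_top ENNReal.ofReal_lt_top ?_⟩
  rw [ENNReal.inv_lt_top, tsub_pos_iff_lt]
  exact hr

/-! ### The centred moment generating function of a gap -/

/-- **Centred m.g.f. bound**: if `λ > 0` and `e^{λΔτ₀}` is integrable with `L = E e^{λΔτ₀}`, then
for `|θ| ≤ λ/2`, `e^{θ(Δτ₀ - 1)}` is integrable and `E e^{θ(Δτ₀ - 1)} ≤ exp(16 e^λ L θ²/λ²)`
(from `e^x ≤ 1 + x + 2x²e^{|x|}`, `x² ≤ (8/λ²) e^{(λ/2)|x|}`, `|Δτ₀ - 1| ≤ Δτ₀ + 1` and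
`E Δτ₀ = 1`). Durrett (2019), §2.7. [folklore] -/
theorem integral_exp_mul_sub_one_le {l : ℝ} (hl : 0 < l)
    (hint : Integrable (fun p ↦ exp (l * gap 0 p)) wienerLawC) {θ : ℝ} (hθ : |θ| ≤ l / 2) :
    Integrable (fun p ↦ exp (θ * (gap 0 p - 1))) wienerLawC ∧
      ∫ p, exp (θ * (gap 0 p - 1)) ∂wienerLawC ≤
        exp (16 * exp l * (∫ p, exp (l * gap 0 p) ∂wienerLawC) / l ^ 2 * θ ^ 2) := by
  set L := ∫ p, exp (l * gap 0 p) ∂wienerLawC with hL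
  have hθl : |θ| ≤ l := hθ.trans (by linarith)
  -- domination of `e^{θ(g-1)}` and of `e^{(l/2)|g-1|}`-type terms by `e^l e^{l g}`
  have hdom1 : ∀ p, exp (θ * (gap 0 p - 1)) ≤ exp l * exp (l * gap 0 p) := by
    intro p
    rw [← Real.exp_add]
    refine Real.exp_le_exp.2 ?_
    have hg := gap_nonneg 0 p
    calc θ * (gap 0 p - 1) ≤ |θ * (gap 0 p - 1)| := le_abs_self _
      _ = |θ| * |gap 0 p - 1| := abs_mul _ _
      _ ≤ l * (gap 0 p + 1) :=
          mul_le_mul hθl ((abs_sub _ _).trans (by rw [abs_of_nonneg hg, abs_one]))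
            (abs_nonneg _) hl.le
      _ = l + l * gap 0 p := by ring
  have hmeasθ : Measurable fun p ↦ exp (θ * (gap 0 p - 1)) :=
    (measurable_const.mul ((measurable_gap 0).sub measurable_const)).exp
  have hintθ : Integrable (fun p ↦ exp (θ * (gap 0 p - 1))) wienerLawC := by
    refine (hint.const_mul (exp l)).mono' hmeasθ.aestronglyMeasurable (ae_of_all _ fun p ↦ ?_)
    rw [Real.norm_eq_abs, abs_of_nonneg (Real.exp_nonneg _)]
    exact hdom1 p
  refine ⟨hintθ, ?_⟩
  -- pointwise: `e^{θX} ≤ 1 + θX + θ² (16 e^l/l²) e^{l g}`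
  have hpt : ∀ p, exp (θ * (gap 0 p - 1)) ≤
      1 + θ * (gap 0 p - 1) + θ ^ 2 * (16 * exp l / l ^ 2) * exp (l * gap 0 p) := by
    intro p
    set X := gap 0 p - 1 with hX
    have hg := gap_nonneg 0 p
    have h1 := exp_le_one_add_add_sq_mul_exp_abs (θ * X)
    -- `X² ≤ (8/l²) e^{(l/2)|X|}`
    have h2 : X ^ 2 ≤ 8 / l ^ 2 * exp (l / 2 * |X|) := by
      have h : (l / 2 * |X|) ^ 2 ≤ 2 * exp (l / 2 * |X|) := by
        have hy : 0 ≤ l / 2 * |X| := by positivity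
        have hq := Real.quadratic_le_exp_of_nonneg hy
        linarith
      rw [mul_pow, sq_abs] at h
      have hl2 : 0 < l ^ 2 := by positivity
      calc X ^ 2 = 4 / l ^ 2 * ((l / 2) ^ 2 * X ^ 2) := by field_simp; ring
        _ ≤ 4 / l ^ 2 * (2 * exp (l / 2 * |X|)) := by gcongr
        _ = 8 / l ^ 2 * exp (l / 2 * |X|) := by ring
    -- `e^{|θX|} ≤ e^{(l/2)|X|}` and `e^{(l/2)|X|} e^{(l/2)|X|} = e^{l|X|} ≤ e^l e^{lg}`
    have h3 : exp |θ * X| ≤ exp (l / 2 * |X|) := by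
      rw [abs_mul]
      exact Real.exp_le_exp.2 (mul_le_mul_of_nonneg_right hθ (abs_nonneg _))
    have h4 : exp (l / 2 * |X|) * exp (l / 2 * |X|) ≤ exp l * exp (l * gap 0 p) := by
      rw [← Real.exp_add, ← Real.exp_add]
      refine Real.exp_le_exp.2 ?_
      have : |X| ≤ gap 0 p + 1 := (abs_sub _ _).trans (by rw [abs_of_nonneg hg, abs_one])
      have := mul_le_mul_of_nonneg_left this hl.le
      linarith
    have h5 : (θ * X) ^ 2 * exp |θ * X| ≤ θ ^ 2 * (8 / l ^ 2) * (exp l * exp (l * gap 0 p)) := by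
      calc (θ * X) ^ 2 * exp |θ * X| = θ ^ 2 * (X ^ 2 * exp |θ * X|) := by ring
        _ ≤ θ ^ 2 * (8 / l ^ 2 * exp (l / 2 * |X|) * exp (l / 2 * |X|)) :=
            mul_le_mul_of_nonneg_left (mul_le_mul h2 h3 (Real.exp_nonneg _) (by positivity))
              (sq_nonneg θ)
        _ = θ ^ 2 * (8 / l ^ 2) * (exp (l / 2 * |X|) * exp (l / 2 * |X|)) := by ring
        _ ≤ θ ^ 2 * (8 / l ^ 2) * (exp l * exp (l * gap 0 p)) := by gcongr
    calc exp (θ * X) ≤ 1 + θ * X + 2 * (θ * X) ^ 2 * exp |θ * X| := h1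
      _ ≤ 1 + θ * X + 2 * (θ ^ 2 * (8 / l ^ 2) * (exp l * exp (l * gap 0 p))) := by
          linarith [h5]
      _ = 1 + θ * X + θ ^ 2 * (16 * exp l / l ^ 2) * exp (l * gap 0 p) := by ring
  -- integrate
  have hintX : Integrable (fun p ↦ θ * (gap 0 p - 1)) wienerLawC :=
    ((integrable_gap 0).sub (integrable_const 1)).const_mul θ
  have hint12 : Integrable (fun p ↦ (1 : ℝ) + θ * (gap 0 p - 1)) wienerLawC :=
    (integrable_const 1).add hintX
  have hint3 : Integrable (fun p ↦ θ ^ 2 * (16 * exp l / l ^ 2) * exp (l * gap 0 p)) wienerLawC :=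
    hint.const_mul _
  have hintR : Integrable (fun p ↦ 1 + θ * (gap 0 p - 1) +
      θ ^ 2 * (16 * exp l / l ^ 2) * exp (l * gap 0 p)) wienerLawC := hint12.add hint3
  have hXint : ∫ p, θ * (gap 0 p - 1) ∂wienerLawC = 0 := by
    rw [integral_const_mul, integral_sub (integrable_gap 0) (integrable_const 1), integral_gap,
      integral_const, probReal_univ, one_smul, sub_self, mul_zero]
  calc ∫ p, exp (θ * (gap 0 p - 1)) ∂wienerLawC
      ≤ ∫ p, (1 + θ * (gap 0 p - 1) + θ ^ 2 * (16 * exp l / l ^ 2) * exp (l * gap 0 p)) ∂wienerLawC :=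
        integral_mono hintθ hintR hpt
    _ = 1 + θ ^ 2 * (16 * exp l / l ^ 2) * L := by
        rw [integral_add (f := fun p ↦ (1 : ℝ) + θ * (gap 0 p - 1))
            (g := fun p ↦ θ ^ 2 * (16 * exp l / l ^ 2) * exp (l * gap 0 p)) hint12 hint3,
          integral_add (f := fun _ ↦ (1 : ℝ)) (g := fun p ↦ θ * (gap 0 p - 1))
            (integrable_const 1) hintX,
          hXint, integral_const_mul, integral_const, probReal_univ, one_smul, add_zero]
    _ ≤ exp (16 * exp l * L / l ^ 2 * θ ^ 2) := by
        have := Real.add_one_le_exp (16 * exp l * L / l ^ 2 * θ ^ 2)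
        have heq : θ ^ 2 * (16 * exp l / l ^ 2) * L = 16 * exp l * L / l ^ 2 * θ ^ 2 := by ring
        linarith

/-! ### The moment generating function of `τ_n - n` -/

/-- **Integrability of `e^{θ(τ_n - n)}`** whenever `e^{θ(Δτ₀ - 1)}` is integrable (renewal
independence: a product of independent integrable factors). [folklore] -/
theorem integrable_exp_mul_tdev {θ : ℝ}
    (h : Integrable (fun p ↦ exp (θ * (gap 0 p - 1))) wienerLawC) (n : ℕ) :
    Integrable (fun p ↦ exp (θ * ((embTime n p : ℝ) - n))) wienerLawC := by
  induction n with
  | zero => simp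
  | succ n ih =>
    have heq : (fun p ↦ exp (θ * ((embTime (n + 1) p : ℝ) - (n + 1 : ℕ)))) =
        (fun p ↦ exp (θ * (gap 0 p - 1))) * (fun p ↦ exp (θ * ((embTime n (next p) : ℝ) - n))) := by
      funext p
      simp only [Pi.mul_apply, tdev_succ', mul_add, Real.exp_add]
    rw [heq]
    have hind : IndepFun (fun p ↦ exp (θ * (gap 0 p - 1))) (fun p ↦ exp (θ * ((embTime n (next p) : ℝ) - n)))
        wienerLawC := by
      have h1 := indepFun_gap_zero_comp_next (F := fun q ↦ exp (θ * ((embTime n q : ℝ) - n)))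
        ((measurable_const.mul (measurable_tdev n)).exp)
      exact h1.comp (φ := fun x : ℝ ↦ exp (θ * (x - 1)))
        (measurable_const.mul (measurable_id.sub measurable_const)).exp measurable_id
    refine hind.integrable_mul h ?_
    exact measurePreserving_next.integrable_comp_of_integrable ih

/-- **`E e^{θ(τ_n - n)} = (E e^{θ(Δτ₀ - 1)})^n`**: the m.g.f. of the centred embedding time
factorises over the i.i.d. gaps (strong Markov at the embedding times). Lawler (1996), §3
("standard exponential estimates"); Durrett (2019), Thm. 8.2.1. [cite: Lawler1996CutTimes, §3] -/
theorem integral_exp_mul_tdev (θ : ℝ) (n : ℕ) :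
    ∫ p, exp (θ * ((embTime n p : ℝ) - n)) ∂wienerLawC = (∫ p, exp (θ * (gap 0 p - 1)) ∂wienerLawC) ^ n := by
  induction n with
  | zero => simp
  | succ n ih =>
    have heq : ∀ p, exp (θ * ((embTime (n + 1) p : ℝ) - (n + 1 : ℕ))) =
        exp (θ * (gap 0 p - 1)) * exp (θ * ((embTime n (next p) : ℝ) - n)) := by
      intro p
      rw [tdev_succ', mul_add, Real.exp_add]
    simp_rw [heq]
    have hind : IndepFun (fun p ↦ exp (θ * (gap 0 p - 1))) (fun p ↦ exp (θ * ((embTime n (next p) : ℝ) - n)))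
        wienerLawC := by
      have h1 := indepFun_gap_zero_comp_next (F := fun q ↦ exp (θ * ((embTime n q : ℝ) - n)))
        ((measurable_const.mul (measurable_tdev n)).exp)
      exact h1.comp (φ := fun x : ℝ ↦ exp (θ * (x - 1)))
        (measurable_const.mul (measurable_id.sub measurable_const)).exp measurable_id
    have hmeas1 : Measurable fun p ↦ exp (θ * (gap 0 p - 1)) :=
      (measurable_const.mul ((measurable_gap 0).sub measurable_const)).exp
    have hmeas2 : Measurable fun q : C(ℝ≥0, ℝ) ↦ exp (θ * ((embTime n q : ℝ) - n)) :=
      (measurable_const.mul (measurable_tdev n)).exp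
    rw [hind.integral_fun_mul_eq_mul_integral hmeas1.aestronglyMeasurable
      (hmeas2.comp measurable_next).aestronglyMeasurable, pow_succ']
    congr 1
    -- `∫ f(next p) = ∫ f` by measure preservation
    have := integral_map (μ := wienerLawC) measurable_next.aemeasurable
      (f := fun q ↦ exp (θ * ((embTime n q : ℝ) - n))) hmeas2.aestronglyMeasurable
    rw [measurePreserving_next.map_eq] at this
    rw [← this, ih]

/-! ### Chernoff bounds for `τ_k - k` -/

/-- **Packaged centred m.g.f. bound**: there are `θ₁ > 0` and `K > 0` with
`E e^{θ(Δτ₀ - 1)} ≤ e^{Kθ²}` (and integrability) for all `|θ| ≤ θ₁`. [folklore] -/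
theorem exists_mgf_bound : ∃ θ₁ K : ℝ, 0 < θ₁ ∧ 0 < K ∧ ∀ θ : ℝ, |θ| ≤ θ₁ →
    Integrable (fun p ↦ exp (θ * (gap 0 p - 1))) wienerLawC ∧
      ∫ p, exp (θ * (gap 0 p - 1)) ∂wienerLawC ≤ exp (K * θ ^ 2) := by
  obtain ⟨l, hl, hρ⟩ := exists_rate
  have hint := integrable_exp_mul_gap hl.le hρ 0
  set L := ∫ p, exp (l * gap 0 p) ∂wienerLawC with hL
  have hLpos : 0 < L := integral_exp_pos hint
  refine ⟨l / 2, 16 * exp l * L / l ^ 2, by linarith, by positivity, fun θ hθ ↦ ?_⟩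
  have h := integral_exp_mul_sub_one_le hl hint hθ
  exact ⟨h.1, h.2.trans_eq (by rw [hL])⟩

/-- The m.g.f. of `τ_k - k` under the packaged bound: `E e^{s(τ_k - k)} ≤ e^{n K s²}` for
`|s| ≤ θ₁`, `k ≤ n`. [folklore] -/
theorem integral_exp_mul_tdev_le {θ₁ K : ℝ} (hK : 0 < K)
    (hmgf : ∀ θ : ℝ, |θ| ≤ θ₁ → Integrable (fun p ↦ exp (θ * (gap 0 p - 1))) wienerLawC ∧
      ∫ p, exp (θ * (gap 0 p - 1)) ∂wienerLawC ≤ exp (K * θ ^ 2))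
    {n k : ℕ} (hk : k ≤ n) {s : ℝ} (hs : |s| ≤ θ₁) :
    ∫ p, exp (s * ((embTime k p : ℝ) - k)) ∂wienerLawC ≤ exp (n * K * s ^ 2) := by
  rw [integral_exp_mul_tdev]
  have h0 : 0 ≤ ∫ p, exp (s * (gap 0 p - 1)) ∂wienerLawC := integral_nonneg fun p ↦ (exp_nonneg _)
  calc (∫ p, exp (s * (gap 0 p - 1)) ∂wienerLawC) ^ k ≤ (exp (K * s ^ 2)) ^ k :=
        pow_le_pow_left₀ h0 (hmgf s hs).2 k
    _ = exp (k * (K * s ^ 2)) := by rw [← Real.exp_nat_mul]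
    _ ≤ exp (n * K * s ^ 2) := by
        refine Real.exp_le_exp.2 ?_
        rw [mul_assoc]
        exact mul_le_mul_of_nonneg_right (by exact_mod_cast hk) (by positivity)

omit [MeasurableSpace C(ℝ≥0, ℝ)] [BorelSpace C(ℝ≥0, ℝ)] in
/-- Optimising the Chernoff exponent: for `t > 0`, `n ≥ 1`, there is `s ∈ [0, θ₁]` with
`-s t + n K s² ≤ -min(t²/(4nK), θ₁ t/2)`. [folklore] -/
theorem exists_chernoff_param {θ₁ K t : ℝ} (hθ₁ : 0 < θ₁) (hK : 0 < K) (ht : 0 < t) {n : ℕ}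
    (hn : 1 ≤ n) : ∃ s : ℝ, 0 ≤ s ∧ s ≤ θ₁ ∧
      -(s * t) + n * K * s ^ 2 ≤ -min (t ^ 2 / (4 * n * K)) (θ₁ * t / 2) := by
  have hn' : (1 : ℝ) ≤ n := by exact_mod_cast hn
  have hnK : 0 < (n : ℝ) * K := by positivity
  by_cases hcase : t ≤ 2 * n * K * θ₁
  · refine ⟨t / (2 * n * K), by positivity, ?_, ?_⟩
    · rw [div_le_iff₀ (by positivity)]
      linarith
    · refine le_trans (le_of_eq ?_) (neg_le_neg (min_le_left _ _))
      field_simp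
      ring
  · push Not at hcase
    refine ⟨θ₁, hθ₁.le, le_rfl, ?_⟩
    refine le_trans ?_ (neg_le_neg (min_le_right _ _))
    have : (n : ℝ) * K * θ₁ ^ 2 < θ₁ * t / 2 := by
      have h1 : (n : ℝ) * K * θ₁ < t / 2 := by linarith
      have := mul_lt_mul_of_pos_left h1 hθ₁
      linarith [this]
    linarith

/-- **Chernoff bound, upper tail**: `P[t ≤ τ_k - k] ≤ exp(-min(t²/(4nK), θ₁t/2))` for `k ≤ n`,
`n ≥ 1`, `t > 0`. Lawler (1996), §3 ("standard exponential estimates"); Durrett (2019), §2.7.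
[cite: Lawler1996CutTimes, §3] -/
theorem measureReal_le_tdev_le {θ₁ K : ℝ} (hθ₁ : 0 < θ₁) (hK : 0 < K)
    (hmgf : ∀ θ : ℝ, |θ| ≤ θ₁ → Integrable (fun p ↦ exp (θ * (gap 0 p - 1))) wienerLawC ∧
      ∫ p, exp (θ * (gap 0 p - 1)) ∂wienerLawC ≤ exp (K * θ ^ 2))
    {n k : ℕ} (hk : k ≤ n) (hn : 1 ≤ n) {t : ℝ} (ht : 0 < t) :
    wienerLawC.real {p | t ≤ ((embTime k p : ℝ) - k)} ≤ exp (-min (t ^ 2 / (4 * n * K)) (θ₁ * t / 2)) := by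
  obtain ⟨s, hs0, hs1, hexp⟩ := exists_chernoff_param hθ₁ hK ht hn
  have hs : |s| ≤ θ₁ := by rwa [abs_of_nonneg hs0]
  have hint : Integrable (fun p ↦ exp (s * ((embTime k p : ℝ) - k))) wienerLawC :=
    integrable_exp_mul_tdev (hmgf s hs).1 k
  calc wienerLawC.real {p | t ≤ ((embTime k p : ℝ) - k)} ≤ exp (-s * t) * mgf (fun p ↦ (embTime k p : ℝ) - k) wienerLawC s :=
        measure_ge_le_exp_mul_mgf t hs0 hint
    _ ≤ exp (-s * t) * exp (n * K * s ^ 2) := by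
        gcongr
        exact integral_exp_mul_tdev_le hK hmgf hk hs
    _ = exp (-(s * t) + n * K * s ^ 2) := by rw [← Real.exp_add, neg_mul]
    _ ≤ exp (-min (t ^ 2 / (4 * n * K)) (θ₁ * t / 2)) := Real.exp_le_exp.2 hexp

/-- **Chernoff bound, lower tail**: `P[τ_k - k ≤ -t] ≤ exp(-min(t²/(4nK), θ₁t/2))`.
[cite: Lawler1996CutTimes, §3] -/
theorem measureReal_tdev_le_neg_le {θ₁ K : ℝ} (hθ₁ : 0 < θ₁) (hK : 0 < K)
    (hmgf : ∀ θ : ℝ, |θ| ≤ θ₁ → Integrable (fun p ↦ exp (θ * (gap 0 p - 1))) wienerLawC ∧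
      ∫ p, exp (θ * (gap 0 p - 1)) ∂wienerLawC ≤ exp (K * θ ^ 2))
    {n k : ℕ} (hk : k ≤ n) (hn : 1 ≤ n) {t : ℝ} (ht : 0 < t) :
    wienerLawC.real {p | ((embTime k p : ℝ) - k) ≤ -t} ≤ exp (-min (t ^ 2 / (4 * n * K)) (θ₁ * t / 2)) := by
  obtain ⟨s, hs0, hs1, hexp⟩ := exists_chernoff_param hθ₁ hK ht hn
  have hs : |-s| ≤ θ₁ := by rwa [abs_neg, abs_of_nonneg hs0]
  have hint : Integrable (fun p ↦ exp (-s * ((embTime k p : ℝ) - k))) wienerLawC :=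
    integrable_exp_mul_tdev (hmgf (-s) hs).1 k
  calc wienerLawC.real {p | ((embTime k p : ℝ) - k) ≤ -t} ≤ exp (-(-s) * (-t)) * mgf (fun p ↦ (embTime k p : ℝ) - k) wienerLawC (-s) :=
        measure_le_le_exp_mul_mgf (-t) (neg_nonpos.2 hs0) hint
    _ ≤ exp (-(-s) * (-t)) * exp (n * K * (-s) ^ 2) := by
        gcongr
        exact integral_exp_mul_tdev_le hK hmgf hk hs
    _ = exp (-(s * t) + n * K * s ^ 2) := by rw [← Real.exp_add]; ring_nf
    _ ≤ exp (-min (t ^ 2 / (4 * n * K)) (θ₁ * t / 2)) := Real.exp_le_exp.2 hexp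

/-- The two-sided deviation event of one embedding time is measurable. [folklore] -/
theorem measurableSet_le_abs_tdev (k : ℕ) (t : ℝ) :
    MeasurableSet {p : C(ℝ≥0, ℝ) | t ≤ |((embTime k p : ℝ) - k)|} :=
  measurableSet_le measurable_const (measurable_tdev k).abs

/-- **Two-sided Chernoff bound**: `P[t ≤ |τ_k - k|] ≤ 2 exp(-min(t²/(4nK), θ₁t/2))`.
[cite: Lawler1996CutTimes, §3] -/
theorem measureReal_le_abs_tdev_le {θ₁ K : ℝ} (hθ₁ : 0 < θ₁) (hK : 0 < K)
    (hmgf : ∀ θ : ℝ, |θ| ≤ θ₁ → Integrable (fun p ↦ exp (θ * (gap 0 p - 1))) wienerLawC ∧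
      ∫ p, exp (θ * (gap 0 p - 1)) ∂wienerLawC ≤ exp (K * θ ^ 2))
    {n k : ℕ} (hk : k ≤ n) (hn : 1 ≤ n) {t : ℝ} (ht : 0 < t) :
    wienerLawC.real {p | t ≤ |((embTime k p : ℝ) - k)|} ≤ 2 * exp (-min (t ^ 2 / (4 * n * K)) (θ₁ * t / 2)) := by
  have hsub : {p : C(ℝ≥0, ℝ) | t ≤ |((embTime k p : ℝ) - k)|} ⊆ {p | t ≤ ((embTime k p : ℝ) - k)} ∪ {p | ((embTime k p : ℝ) - k) ≤ -t} := by
    intro p hp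
    simp only [mem_setOf_eq, mem_union] at hp ⊢
    rcases le_abs'.1 hp with h | h
    · exact Or.inr h
    · exact Or.inl h
  calc wienerLawC.real {p | t ≤ |((embTime k p : ℝ) - k)|}
      ≤ wienerLawC.real ({p | t ≤ ((embTime k p : ℝ) - k)} ∪ {p | ((embTime k p : ℝ) - k) ≤ -t}) := measureReal_mono hsub
    _ ≤ wienerLawC.real {p | t ≤ ((embTime k p : ℝ) - k)} + wienerLawC.real {p | ((embTime k p : ℝ) - k) ≤ -t} :=
        measureReal_union_le _ _
    _ ≤ exp (-min (t ^ 2 / (4 * n * K)) (θ₁ * t / 2)) +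
          exp (-min (t ^ 2 / (4 * n * K)) (θ₁ * t / 2)) :=
        add_le_add (measureReal_le_tdev_le hθ₁ hK hmgf hk hn ht)
          (measureReal_tdev_le_neg_le hθ₁ hK hmgf hk hn ht)
    _ = 2 * exp (-min (t ^ 2 / (4 * n * K)) (θ₁ * t / 2)) := by ring

/-- **Maximal two-sided bound**: `P[∃ k ≤ n, t ≤ |τ_k - k|] ≤ 4n exp(-min(t²/(4nK), θ₁t/2))`
(union bound over `k ≤ n`). [cite: Lawler1996CutTimes, §3] -/
theorem measureReal_exists_le_abs_tdev_le_aux {θ₁ K : ℝ} (hθ₁ : 0 < θ₁) (hK : 0 < K)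
    (hmgf : ∀ θ : ℝ, |θ| ≤ θ₁ → Integrable (fun p ↦ exp (θ * (gap 0 p - 1))) wienerLawC ∧
      ∫ p, exp (θ * (gap 0 p - 1)) ∂wienerLawC ≤ exp (K * θ ^ 2))
    {n : ℕ} (hn : 1 ≤ n) {t : ℝ} (ht : 0 < t) :
    wienerLawC.real {p | ∃ k ≤ n, t ≤ |((embTime k p : ℝ) - k)|} ≤
      4 * n * exp (-min (t ^ 2 / (4 * n * K)) (θ₁ * t / 2)) := by
  have hset : {p : C(ℝ≥0, ℝ) | ∃ k ≤ n, t ≤ |((embTime k p : ℝ) - k)|} =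
      ⋃ k ∈ Finset.range (n + 1), {p | t ≤ |((embTime k p : ℝ) - k)|} := by
    ext p
    simp
  rw [hset]
  refine (measureReal_biUnion_finset_le _ _).trans ?_
  calc ∑ k ∈ Finset.range (n + 1), wienerLawC.real {p | t ≤ |((embTime k p : ℝ) - k)|}
      ≤ ∑ k ∈ Finset.range (n + 1), 2 * exp (-min (t ^ 2 / (4 * n * K)) (θ₁ * t / 2)) :=
        Finset.sum_le_sum fun k hk ↦ measureReal_le_abs_tdev_le hθ₁ hK hmgf
          (Nat.lt_succ_iff.1 (Finset.mem_range.1 hk)) hn ht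
    _ = 2 * (n + 1) * exp (-min (t ^ 2 / (4 * n * K)) (θ₁ * t / 2)) := by
        rw [Finset.sum_const, Finset.card_range, nsmul_eq_mul]
        push_cast
        ring
    _ ≤ 4 * n * exp (-min (t ^ 2 / (4 * n * K)) (θ₁ * t / 2)) := by
        have hn' : (1 : ℝ) ≤ n := by exact_mod_cast hn
        have : (2 : ℝ) * (n + 1) ≤ 4 * n := by linarith
        exact mul_le_mul_of_nonneg_right this (exp_nonneg _)

omit [MeasurableSpace C(ℝ≥0, ℝ)] [BorelSpace C(ℝ≥0, ℝ)] in
/-- **Absorbing a polynomial prefactor into a stretched exponential**: for `c, d > 0` there is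
`a > 0` with `4 n e^{-c n^d} ≤ a e^{-n^{d/2}}` for all `n ≥ 1`. [folklore] -/
theorem exists_absorb_prefactor {c d : ℝ} (hc : 0 < c) (hd : 0 < d) :
    ∃ a : ℝ, 0 < a ∧ ∀ n : ℕ, 1 ≤ n →
      4 * (n : ℝ) * exp (-(c * (n : ℝ) ^ d)) ≤ a * exp (-(n : ℝ) ^ (d / 2)) := by
  set A := ((1 / d) / (c / 2)) ^ (1 / d) * exp (-(1 / d)) with hA
  have hApos : 0 < A := by positivity
  refine ⟨4 * A * exp (1 / (2 * c)), by positivity, fun n hn ↦ ?_⟩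
  have hn0 : (0 : ℝ) ≤ n := by positivity
  set y := (n : ℝ) ^ (d / 2) with hy
  set z := (n : ℝ) ^ d with hz
  have hy0 : 0 ≤ y := by positivity
  have hz0 : 0 ≤ z := by positivity
  have hzy : z = y ^ 2 := by
    rw [hy, hz, ← Real.rpow_natCast, ← Real.rpow_mul hn0]
    congr 1
    push_cast
    ring
  have hnz : (n : ℝ) = z ^ (1 / d) := by
    rw [hz, ← Real.rpow_mul hn0, mul_one_div_cancel hd.ne', Real.rpow_one]
  -- `-c z ≤ -(c/2) z - y + 1/(2c)`
  have hsq := neg_mul_sq_add_le hc y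
  rw [← hzy] at hsq
  -- `z^{1/d} e^{-(c/2) z} ≤ A`
  have hmax : z ^ (1 / d) * exp (-(c / 2 * z)) ≤ A := by
    rw [hA]
    exact rpow_mul_exp_neg_mul_le hz0 (half_pos hc) (one_div_pos.2 hd)
  have hexp : exp (-(c * z)) ≤ exp (-(c / 2 * z)) * (exp (1 / (2 * c)) * exp (-y)) := by
    rw [← Real.exp_add, ← Real.exp_add]
    exact Real.exp_le_exp.2 (by linarith)
  calc 4 * (n : ℝ) * exp (-(c * z)) = 4 * (z ^ (1 / d) * exp (-(c * z))) := by rw [hnz]; ring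
    _ ≤ 4 * (z ^ (1 / d) * (exp (-(c / 2 * z)) * (exp (1 / (2 * c)) * exp (-y)))) := by
        gcongr
    _ = 4 * (z ^ (1 / d) * exp (-(c / 2 * z))) * exp (1 / (2 * c)) * exp (-y) := by ring
    _ ≤ 4 * A * exp (1 / (2 * c)) * exp (-y) := by gcongr

/-- **Exponential control of the embedding times** (Lawler (1996), §3, second display): for
every `ε > 0` there are `δ > 0` and `a < ∞` such that for all `n ≥ 1`,
`P{sup_{0 ≤ i ≤ n} |τ_i - i| ≥ n^{1/2+ε}} ≤ a e^{-n^δ}`. [cite: Lawler1996CutTimes, §3] -/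
theorem measureReal_exists_le_abs_tdev_le {e : ℝ} (he : 0 < e) :
    ∃ δ : ℝ, 0 < δ ∧ ∃ a : ℝ, 0 < a ∧ ∀ n : ℕ, 1 ≤ n →
      wienerLawC.real {p | ∃ k ≤ n, (n : ℝ) ^ (1 / 2 + e) ≤ |((embTime k p : ℝ) - k)|} ≤
        a * exp (-(n : ℝ) ^ δ) := by
  obtain ⟨θ₁, K, hθ₁, hK, hmgf⟩ := exists_mgf_bound
  set c := min (1 / (4 * K)) (θ₁ / 2) with hc
  have hcpos : 0 < c := lt_min (by positivity) (by positivity)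
  set d := min (2 * e) (1 / 2 + e) with hd
  have hdpos : 0 < d := lt_min (by positivity) (by positivity)
  obtain ⟨a, ha, habs⟩ := exists_absorb_prefactor hcpos hdpos
  refine ⟨d / 2, by positivity, a, ha, fun n hn ↦ ?_⟩
  have hn1 : (1 : ℝ) ≤ n := by exact_mod_cast hn
  have hn0 : (0 : ℝ) < n := by positivity
  set t := (n : ℝ) ^ (1 / 2 + e) with ht
  have htpos : 0 < t := Real.rpow_pos_of_pos hn0 _
  refine (measureReal_exists_le_abs_tdev_le_aux hθ₁ hK hmgf hn htpos).trans ?_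
  refine le_trans ?_ (habs n hn)
  -- compare the exponents: `c n^d ≤ min (t²/(4nK)) (θ₁ t/2)`
  have hnd : (n : ℝ) ^ d ≤ (n : ℝ) ^ (2 * e) :=
    Real.rpow_le_rpow_of_exponent_le hn1 (min_le_left _ _)
  have hnd' : (n : ℝ) ^ d ≤ t := Real.rpow_le_rpow_of_exponent_le hn1 (min_le_right _ _)
  have ht2 : t ^ 2 / (4 * n * K) = (n : ℝ) ^ (2 * e) / (4 * K) := by
    have : t ^ 2 = (n : ℝ) * (n : ℝ) ^ (2 * e) := by
      rw [ht, ← Real.rpow_natCast, ← Real.rpow_mul hn0.le,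
        show (1 / 2 + e) * ((2 : ℕ) : ℝ) = 1 + 2 * e by push_cast; ring,
        Real.rpow_add hn0, Real.rpow_one]
    rw [this]
    field_simp
  have hmin : c * (n : ℝ) ^ d ≤ min (t ^ 2 / (4 * n * K)) (θ₁ * t / 2) := by
    refine le_min ?_ ?_
    · rw [ht2]
      calc c * (n : ℝ) ^ d ≤ 1 / (4 * K) * (n : ℝ) ^ (2 * e) :=
            mul_le_mul (min_le_left _ _) hnd (by positivity) (by positivity)
        _ = (n : ℝ) ^ (2 * e) / (4 * K) := by ring
    · calc c * (n : ℝ) ^ d ≤ θ₁ / 2 * t :=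
            mul_le_mul (min_le_right _ _) hnd' (by positivity) (by positivity)
        _ = θ₁ * t / 2 := by ring
  gcongr 4 * (n : ℝ) * ?_
  exact Real.exp_le_exp.2 (neg_le_neg hmin)

end Law

end SkorokhodSRW

end Literature.Probability.RandomPlanarGeometry
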